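import Summits.RiemannHypothesis.RiemannHypothesis.Theorems.SuzukiWindowsDoorArchLeadingTerm
import Summits.RiemannHypothesis.RiemannHypothesis.Theorems.SuzukiWindowsDoorWindowDilation
import Summits.RiemannHypothesis.RiemannHypothesis.Theorems.SuzukiWindowFactorisation

/-!
# SuzukiWindowsDoorSmallWindowLaw — the SMALL-WINDOW LAW `‖𝖪_θ[t]‖ = c_θ‖A_θ‖t^θ(1 + O(t))` of Suzuki's window norms as a THEOREM (column DBR; RH-FREE)

LINE 1 — LABEL: RH-FREE structure theorems (asymptotics with explicit constants) about ONE explicit operator family,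
Suzuki's single operator `𝖪_θ[t]` on `L²(−t,t)` ([Su20] = arXiv:1907.07302, (1.4)/(1.10), kernel `K_θ = limKernel θ`);
bears_on: LADDER-RH B-D(b) → B-P(P2) (PROOF-OF-DATA for DATA.md §ET1f-lite; rh-dbr TARGET-v9 §M.3 T2 «the small-`t` law
limit `lim_{t↓0} σ₁(θ,t)/t^θ = c_θ‖A_θ‖` if reachable»; D-0117: a structural LAW, not a range extension).  WHAT THIS IS
NOT: no window is moved or certified here, nothing is a statement about `ζ`'s zeros, the residual `AllWindowsWitness`
(stmt-19733) stays RH-EQUIVALENT and unclaimed; nothing here bears on the truth of RH.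

THE LAW.  For integer `θ = k + 1 ≥ 2` (the `θ ∈ ℕ` of the column's engines ET1e/ET1f), write `c_θ = (2π)^θ/Γ(θ) = (2π)^θ/k!`
and let `A_θ` be the ONSET OPERATOR: the window operator on `L²(−1,1)` with the homogeneous kernel `(u+v)₊^k`
(`SuzukiWindowsDoorKernelMonotone`, `SuzukiWindowsDoorWindowDilation` §2; DATA §ET1f-lite certified `‖A_θ‖`, `θ = 2…7`).
In the tree's hypothesis style (ANY bounded `A` on `L²(−t,t)` with the a.e. kernel formula
`(Aφ)(x) = ∫_{(−t,t)} K_θ(x+y)φ(y)dy`, ANY bounded `B` on `L²(−1,1)` with the kernel `(u+v)₊^k`; no definition introduced):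

* §1 **`abs_opNorm_winOp_sub_leading_le`**: `|‖A‖ − c_θ‖B‖t^θ| ≤ 2D_θ t^{θ+1}` for `0 < t ≤ 1/12`,
  `D_θ = c_θ 2^{θ−1} + 6θ(4πe/θ)^θ`; **`tendsto_opNorm_winOp_div_pow`**: `‖A_t‖/t^θ → c_θ‖B‖` as `t → 0⁺` for any
  family of realisations `A_t` — i.e. `σ₁(θ,t) = ‖𝖪_θ[t]‖ = c_θ‖A_θ‖t^θ(1 + O(t))`, the law MEASURED in §ET1f-lite
  (`c_θ‖A_θ‖ = 44.9126805 / 180.207346 / 553.934048 / …`, `θ = 2, 3, 4, …`; the `O(t)` constant here is explicit but crude,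
  `2D_θ/(c_θ‖A_θ‖) ≈ 160 (θ = 2) … 1100 (θ = 7)`, against the fitted first-order coefficient `κ_θ ≈ −4.3 … −6.1`);
* §2 realisation-free band (with `SuzukiWindowsDoorWindowDilation`'s `2^{2θ}/(θ²(2θ+1)) ≤ ‖A_θ‖² ≤ 2^{2θ}/((2θ−1)2θ)`):
  `c_θ 2^θ/(θ√(2θ+1))·t^θ − 2D_θt^{θ+1} ≤ ‖A‖ ≤ c_θ 2^θ/√((2θ−1)2θ)·t^θ + 2D_θt^{θ+1}` — in particular the first
  LOWER bound on Suzuki's window norms in the tree: `‖𝖪_θ[t]‖` is exactly of order `t^θ` as `t → 0⁺`.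

METHOD.  Dilation to `L²(−1,1)` (`SuzukiWindowsDoorWindowDilation.opNorm_winOp_eq_dilate`); the dilated kernel splits as
`t·K_θ(tw) = c_θ t^θ w₊^k + E_t(w)` with `|E_t| ≤ D_θ t^{θ+1}` on the window (`abs_dilKernel_sub_leading_le`, from the
small-`x` law `SuzukiWindowsDoorArchLeadingTerm.abs_limKernel_sub_leading_le` at `x = tw ≤ 1/6` and `1 − e^{−x/2} ≤ x/2`);
the error operator `B̃_t − c_θt^θ•B` has the kernel `E_t(u+v)`, so its norm is `≤ √(∫∫E_t²) ≤ 2D_θt^{θ+1}`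
(`SuzukiWindowsDoorExplicitOpNorm.opNorm_winOp_le_sqrt`); reverse triangle inequality.

References: [Su20] M. Suzuki, *An integral operator …*, ASPM 84 (2020) = arXiv:1907.07302, (1.4), (1.10)–(1.12), §3
(`g_θ` «by Stirling's formula»); DATA.md §ET1f-lite (kit j254878; `c_θ‖A_θ‖`, `η₁ = −7/2`, `κ_θ`), §ET1e (σ₁(θ,t) column);
rh-dbr TARGET-v8 §L.4 (ii), TARGET-v9 §M.3 T2.
-/

noncomputable section

-- D-0017: `Summit.<S>.<S>.…` is the designed namespace of a single-problem summit.
set_option linter.dupNamespace false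

open MeasureTheory Set Filter Topology

namespace Summit.RiemannHypothesis.RiemannHypothesis.Theorems.SuzukiWindowsDoorSmallWindowLaw

open Literature.NumberTheory.LFunctions Literature.Analysis.OperatorTheory
open Summit.RiemannHypothesis.RiemannHypothesis.Theorems.SuzukiWindowsDoorTempleGalerkin
open Summit.RiemannHypothesis.RiemannHypothesis.Theorems.SuzukiWindowsDoorExplicitOpNorm
open Summit.RiemannHypothesis.RiemannHypothesis.Theorems.SuzukiWindowsDoorArchLeadingTerm
open Summit.RiemannHypothesis.RiemannHypothesis.Theorems.SuzukiWindowsDoorWindowDilation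
open Summit.RiemannHypothesis.RiemannHypothesis.Theorems.SuzukiKernelSemigroup (limKernel_eq_zero_of_nonpos)

/-! ## §1 The small-window law for `𝖪_θ[t]`, integer `θ = k + 1 ≥ 2` -/

section Law

/-- RH-FREE.  **The dilated kernel minus its leading term**: for integer `θ = k+1 ≥ 2`, `0 < t ≤ 1/12` and `w < 2`,
`|t·K_θ(tw) − c_θ t^θ w₊^k| ≤ D_θ t^{θ+1}`, with `c_θ = (2π)^θ/k!` and
`D_θ = c_θ 2^k + 6θ(4πe/θ)^θ` (from the small-`x` law `abs_limKernel_sub_leading_le` at `x = tw ≤ 1/6` and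
`1 − e^{−x/2} ≤ x/2`; for `w ≤ 0` both terms vanish). -/
theorem abs_dilKernel_sub_leading_le {k : ℕ} (hk : 1 ≤ k) {t : ℝ} (ht0 : 0 < t) (ht : t ≤ 1 / 12)
    {w : ℝ} (hw : w < 2) :
    |t * limKernel ((k : ℝ) + 1) (t * w) -
        (2 * Real.pi) ^ (k + 1) / (k.factorial : ℝ) * t ^ (k + 1) * (max w 0) ^ k| ≤
      ((2 * Real.pi) ^ (k + 1) / (k.factorial : ℝ) * 2 ^ k +
          6 * ((k : ℝ) + 1) * (4 * Real.pi * Real.exp 1 / ((k : ℝ) + 1)) ^ (k + 1)) * t ^ (k + 2) := by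
  have hk0 : (0 : ℝ) ≤ k := Nat.cast_nonneg k
  have hθ : (1 : ℝ) < (k : ℝ) + 1 := by linarith [show (1 : ℝ) ≤ k from by exact_mod_cast hk]
  set c : ℝ := (2 * Real.pi) ^ (k + 1) / (k.factorial : ℝ) with hcdef
  have hc0 : 0 ≤ c := by positivity
  have hD2 : 0 ≤ 6 * ((k : ℝ) + 1) * (4 * Real.pi * Real.exp 1 / ((k : ℝ) + 1)) ^ (k + 1) := by positivity
  rcases le_or_gt w 0 with hw0 | hw0
  · have h1 : limKernel ((k : ℝ) + 1) (t * w) = 0 :=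
      limKernel_eq_zero_of_nonpos hθ (mul_nonpos_of_nonneg_of_nonpos ht0.le hw0)
    have h2 : (max w 0) ^ k = 0 := by rw [max_eq_right hw0, zero_pow (by omega)]
    rw [h1, h2, mul_zero, mul_zero, sub_zero, abs_zero]
    positivity
  · set x : ℝ := t * w with hxdef
    have hx0 : 0 < x := mul_pos ht0 hw0
    have hx2t : x ≤ 2 * t := by rw [hxdef]; nlinarith
    have hx : x ≤ 1 / 6 := by linarith
    have hK := abs_limKernel_sub_leading_le hk hx0 hx
    have hmax : max w 0 = w := max_eq_left hw0.le
    -- the decomposition `tK(x) − c t^{k+1} w^k = t(K(x) − lead(x)) − c t^{k+1} w^k (1 − e^{−x/2})`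
    have hlead : t * ((2 * Real.pi) ^ (k + 1) * (x ^ k * Real.exp (-(x / 2)) / (k.factorial : ℝ))) =
        c * t ^ (k + 1) * w ^ k * Real.exp (-(x / 2)) := by
      rw [hxdef, hcdef, mul_pow, pow_succ]; ring
    have hdecomp : t * limKernel ((k : ℝ) + 1) x - c * t ^ (k + 1) * (max w 0) ^ k =
        t * (limKernel ((k : ℝ) + 1) x - (2 * Real.pi) ^ (k + 1) * (x ^ k * Real.exp (-(x / 2)) / (k.factorial : ℝ)))
          - c * t ^ (k + 1) * w ^ k * (1 - Real.exp (-(x / 2))) := by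
      rw [hmax, mul_sub t, hlead]; ring
    -- first piece
    have hT1 : |t * (limKernel ((k : ℝ) + 1) x -
        (2 * Real.pi) ^ (k + 1) * (x ^ k * Real.exp (-(x / 2)) / (k.factorial : ℝ)))| ≤
        6 * ((k : ℝ) + 1) * (4 * Real.pi * Real.exp 1 / ((k : ℝ) + 1)) ^ (k + 1) * t ^ (k + 2) := by
      rw [abs_mul, abs_of_pos ht0]
      have hexp1 : Real.exp (-(x / 2)) ≤ 1 := Real.exp_le_one_iff.mpr (by linarith)
      have hbase : 2 * Real.pi * Real.exp 1 * x / ((k : ℝ) + 1) ≤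
          4 * Real.pi * Real.exp 1 / ((k : ℝ) + 1) * t := by
        rw [show 4 * Real.pi * Real.exp 1 / ((k : ℝ) + 1) * t =
          2 * Real.pi * Real.exp 1 * (2 * t) / ((k : ℝ) + 1) by ring]
        gcongr
      have hbase0 : 0 ≤ 2 * Real.pi * Real.exp 1 * x / ((k : ℝ) + 1) := by positivity
      calc t * |limKernel ((k : ℝ) + 1) x -
              (2 * Real.pi) ^ (k + 1) * (x ^ k * Real.exp (-(x / 2)) / (k.factorial : ℝ))|
          ≤ t * (6 * ((k : ℝ) + 1) * (2 * Real.pi * Real.exp 1 * x / ((k : ℝ) + 1)) ^ (k + 1) *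
              Real.exp (-(x / 2))) := mul_le_mul_of_nonneg_left hK ht0.le
        _ ≤ t * (6 * ((k : ℝ) + 1) * (4 * Real.pi * Real.exp 1 / ((k : ℝ) + 1) * t) ^ (k + 1) * 1) := by
            gcongr
        _ = 6 * ((k : ℝ) + 1) * (4 * Real.pi * Real.exp 1 / ((k : ℝ) + 1)) ^ (k + 1) * t ^ (k + 2) := by
            rw [mul_pow]; ring
    -- second piece
    have hT2 : |c * t ^ (k + 1) * w ^ k * (1 - Real.exp (-(x / 2)))| ≤ c * 2 ^ k * t ^ (k + 2) := by
      have h1e : 0 ≤ 1 - Real.exp (-(x / 2)) := by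
        have : Real.exp (-(x / 2)) ≤ 1 := Real.exp_le_one_iff.mpr (by linarith)
        linarith
      have h1e' : 1 - Real.exp (-(x / 2)) ≤ t := by
        have := Real.add_one_le_exp (-(x / 2))
        nlinarith
      have hwk : w ^ k ≤ 2 ^ k := pow_le_pow_left₀ hw0.le hw.le k
      rw [abs_of_nonneg (by positivity)]
      calc c * t ^ (k + 1) * w ^ k * (1 - Real.exp (-(x / 2)))
          ≤ c * t ^ (k + 1) * 2 ^ k * t := by gcongr
        _ = c * 2 ^ k * t ^ (k + 2) := by ring
    rw [hdecomp]
    calc |t * (limKernel ((k : ℝ) + 1) x -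
            (2 * Real.pi) ^ (k + 1) * (x ^ k * Real.exp (-(x / 2)) / (k.factorial : ℝ)))
          - c * t ^ (k + 1) * w ^ k * (1 - Real.exp (-(x / 2)))|
        ≤ |t * (limKernel ((k : ℝ) + 1) x -
            (2 * Real.pi) ^ (k + 1) * (x ^ k * Real.exp (-(x / 2)) / (k.factorial : ℝ)))|
          + |c * t ^ (k + 1) * w ^ k * (1 - Real.exp (-(x / 2)))| := abs_sub _ _
      _ ≤ 6 * ((k : ℝ) + 1) * (4 * Real.pi * Real.exp 1 / ((k : ℝ) + 1)) ^ (k + 1) * t ^ (k + 2)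
          + c * 2 ^ k * t ^ (k + 2) := add_le_add hT1 hT2
      _ = (c * 2 ^ k + 6 * ((k : ℝ) + 1) * (4 * Real.pi * Real.exp 1 / ((k : ℝ) + 1)) ^ (k + 1)) *
          t ^ (k + 2) := by ring

/-- RH-FREE · **THE SMALL-WINDOW LAW OF SUZUKI'S WINDOW NORMS** (quantitative form).  For integer
`θ = k + 1 ≥ 2`, `0 < t ≤ 1/12`, ANY bounded realisation `A` of `𝖪_θ[t]` on `L²(−t,t)` (a.e. kernel formula with
`K_θ(x+y)`) and ANY bounded realisation `B` of the onset operator `A_θ` on `L²(−1,1)` (kernel `(u+v)₊^k`):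

  `|‖A‖ − c_θ ‖B‖ t^θ| ≤ 2 D_θ t^{θ+1}`,  `c_θ = (2π)^θ/Γ(θ)`, `D_θ = c_θ 2^{θ−1} + 6θ(4πe/θ)^θ`.

So `σ₁(θ,t) = ‖𝖪_θ[t]‖ = c_θ‖A_θ‖t^θ(1 + O(t))` — the law measured in DATA.md §ET1f-lite (certified `c_θ‖A_θ‖`,
`θ = 2…7`) is a theorem, with an explicit `O`.  Proof: dilation to `L²(−1,1)` (`opNorm_winOp_eq_dilate`), the kernel
split `tK_θ(tw) = c_θ t^θ w₊^k + E_t(w)`, `|E_t| ≤ D_θ t^{θ+1}` on the window (`abs_dilKernel_sub_leading_le`), the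
Hilbert–Schmidt bound `‖op(E_t)‖ ≤ 2D_θ t^{θ+1}` (`opNorm_winOp_le_sqrt`) and the reverse triangle inequality.
A statement about one explicit operator family; nothing here bears on RH. -/
theorem abs_opNorm_winOp_sub_leading_le {k : ℕ} (hk : 1 ≤ k) {θ : ℝ} (hθ : θ = (k : ℝ) + 1)
    {t : ℝ} (ht0 : 0 < t) (ht : t ≤ 1 / 12)
    {A : Lp ℝ 2 (volume.restrict (Ioo (-t) t)) →L[ℝ] Lp ℝ 2 (volume.restrict (Ioo (-t) t))}
    (hA : ∀ φ, (A φ : ℝ → ℝ) =ᵐ[volume.restrict (Ioo (-t) t)]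
      fun x => ∫ y in Ioo (-t) t, limKernel θ (x + y) * φ y)
    {B : Lp ℝ 2 (volume.restrict (Ioo (-1 : ℝ) 1)) →L[ℝ] Lp ℝ 2 (volume.restrict (Ioo (-1 : ℝ) 1))}
    (hB : ∀ φ, (B φ : ℝ → ℝ) =ᵐ[volume.restrict (Ioo (-1 : ℝ) 1)]
      fun u => ∫ v in Ioo (-1 : ℝ) 1, (max (u + v) 0) ^ k * φ v) :
    |‖A‖ - (2 * Real.pi) ^ (k + 1) / (k.factorial : ℝ) * ‖B‖ * t ^ (k + 1)| ≤
      2 * ((2 * Real.pi) ^ (k + 1) / (k.factorial : ℝ) * 2 ^ k +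
          6 * ((k : ℝ) + 1) * (4 * Real.pi * Real.exp 1 / ((k : ℝ) + 1)) ^ (k + 1)) * t ^ (k + 2) := by
  subst hθ
  have hk0 : (0 : ℝ) ≤ k := Nat.cast_nonneg k
  have hθ1 : (1 : ℝ) < (k : ℝ) + 1 := by linarith [show (1 : ℝ) ≤ k from by exact_mod_cast hk]
  set c : ℝ := (2 * Real.pi) ^ (k + 1) / (k.factorial : ℝ) with hcdef
  set D : ℝ := c * 2 ^ k + 6 * ((k : ℝ) + 1) * (4 * Real.pi * Real.exp 1 / ((k : ℝ) + 1)) ^ (k + 1) with hDdef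
  have hc0 : 0 ≤ c := by positivity
  have hD0 : 0 ≤ D := by positivity
  set s : ℝ := c * t ^ (k + 1) with hsdef
  have hs0 : 0 ≤ s := by positivity
  have hKc : Continuous (limKernel ((k : ℝ) + 1)) := Suzuki2020_thm12_continuous hθ1
  -- the dilated kernel and a realisation of its window operator on `L²(−1,1)`
  set Kt : ℝ → ℝ := fun w => t * limKernel ((k : ℝ) + 1) (t * w) with hKtdef
  have hKt : Continuous Kt := continuous_const.mul (hKc.comp (continuous_const.mul continuous_id))
  obtain ⟨Bt, hBt⟩ := exists_winOp hKt 1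
  have hnorm : ‖A‖ = ‖Bt‖ := opNorm_winOp_eq_dilate ht0 hA hBt
  -- the onset kernel
  set b : ℝ → ℝ := fun w => (max w 0) ^ k with hbdef
  have hb : Continuous b := (continuous_id.max continuous_const).pow k
  -- the error kernel and its operator `Bt − s•B`
  set E : ℝ → ℝ := fun w => Kt w - s * b w with hEdef
  have hE : Continuous E := hKt.sub (continuous_const.mul hb)
  have hEop : ∀ φ : Lp ℝ 2 (volume.restrict (Ioo (-1 : ℝ) 1)),
      (((Bt - s • B) φ : Lp ℝ 2 (volume.restrict (Ioo (-1 : ℝ) 1))) : ℝ → ℝ)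
        =ᵐ[volume.restrict (Ioo (-1 : ℝ) 1)] fun u => ∫ v in Ioo (-1 : ℝ) 1, E (u + v) * φ v := by
    intro φ
    have hsec1 := ae_memLp_l2Kernel_section (memLp_winKernel hKt 1)
    have hsec2 := ae_memLp_l2Kernel_section (memLp_winKernel hb 1)
    rw [show (Bt - s • B) φ = Bt φ - s • B φ from rfl]
    filter_upwards [Lp.coeFn_sub (Bt φ) (s • B φ), Lp.coeFn_smul s (B φ), hBt φ, hB φ, hsec1, hsec2]
      with u hsub hsmul h1 h2 hu1 hu2
    have hi1 : Integrable (fun v => Kt (u + v) * φ v) (volume.restrict (Ioo (-1 : ℝ) 1)) :=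
      hu1.integrable_mul (Lp.memLp φ)
    have hi2 : Integrable (fun v => s * (max (u + v) 0 ^ k * φ v)) (volume.restrict (Ioo (-1 : ℝ) 1)) :=
      (hu2.integrable_mul (Lp.memLp φ)).const_mul s
    rw [hsub, Pi.sub_apply, hsmul, Pi.smul_apply, h1, h2, smul_eq_mul, ← integral_const_mul,
      ← integral_sub hi1 hi2]
    refine integral_congr_ae (Eventually.of_forall fun v => ?_)
    simp only [hEdef, hKtdef, hbdef]
    ring
  -- pointwise bound on the error kernel on the window
  have hEbd : ∀ w : ℝ, w < 2 → |E w| ≤ D * t ^ (k + 2) := fun w hw => by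
    have h := abs_dilKernel_sub_leading_le hk ht0 ht hw
    simp only [hEdef, hKtdef, hbdef, hsdef]
    rwa [hDdef, hcdef]
  -- Hilbert–Schmidt bound for the error operator
  have hHS : ‖Bt - s • B‖ ≤ 2 * D * t ^ (k + 2) := by
    refine (opNorm_winOp_le_sqrt (t := 1) hE hEop).trans ?_
    have hin : ∀ u ∈ Ioo (-1 : ℝ) 1, ∫ v in Ioo (-1 : ℝ) 1, E (u + v) ^ 2 ≤ 2 * (D * t ^ (k + 2)) ^ 2 := by
      intro u hu
      have hcu : Continuous fun v => E (u + v) ^ 2 := (hE.comp (continuous_const.add continuous_id)).pow 2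
      have h1 : ∫ v in Ioo (-1 : ℝ) 1, E (u + v) ^ 2 ≤ ∫ v in Ioo (-1 : ℝ) 1, (D * t ^ (k + 2)) ^ 2 := by
        refine setIntegral_mono_on (hcu.integrableOn_Icc.mono_set Ioo_subset_Icc_self)
          (by exact integrableOn_const (by simp)) measurableSet_Ioo fun v hv => ?_
        have hlt : u + v < 2 := by linarith [hu.2, hv.2]
        have hab := hEbd (u + v) hlt
        rw [← sq_abs]
        exact pow_le_pow_left₀ (abs_nonneg _) hab 2
      rw [setIntegral_const, Real.volume_real_Ioo_of_le (by norm_num), show (1 : ℝ) - -1 = 2 by norm_num,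
        smul_eq_mul] at h1
      exact h1
    have hout : ∫ u in Ioo (-1 : ℝ) 1, ∫ v in Ioo (-1 : ℝ) 1, E (u + v) ^ 2 ≤ (2 * D * t ^ (k + 2)) ^ 2 := by
      have h1 : ∫ u in Ioo (-1 : ℝ) 1, ∫ v in Ioo (-1 : ℝ) 1, E (u + v) ^ 2 ≤
          ∫ u in Ioo (-1 : ℝ) 1, 2 * (D * t ^ (k + 2)) ^ 2 :=
        setIntegral_mono_on (integrable_integral_l2Kernel_sq (memLp_winKernel hE 1))
          (by exact integrableOn_const (by simp)) measurableSet_Ioo hin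
      rw [setIntegral_const, Real.volume_real_Ioo_of_le (by norm_num), show (1 : ℝ) - -1 = 2 by norm_num,
        smul_eq_mul] at h1
      refine h1.trans (le_of_eq ?_)
      ring
    calc Real.sqrt (∫ u in Ioo (-1 : ℝ) 1, ∫ v in Ioo (-1 : ℝ) 1, E (u + v) ^ 2)
        ≤ Real.sqrt ((2 * D * t ^ (k + 2)) ^ 2) := Real.sqrt_le_sqrt hout
      _ = 2 * D * t ^ (k + 2) := Real.sqrt_sq (by positivity)
  -- reverse triangle inequality
  have htri : |‖Bt‖ - ‖s • B‖| ≤ ‖Bt - s • B‖ := abs_norm_sub_norm_le Bt (s • B)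
  rw [norm_smul, Real.norm_of_nonneg hs0] at htri
  rw [hnorm, show c * ‖B‖ * t ^ (k + 1) = s * ‖B‖ by rw [hsdef]; ring]
  exact htri.trans hHS

/-- RH-FREE · **THE SMALL-WINDOW LAW, limit form**: for integer `θ = k+1 ≥ 2`, any family of bounded realisations
`A t` of `𝖪_θ[t]` (`t > 0`) and any realisation `B` of the onset operator `A_θ`,
`‖A t‖ / t^θ → c_θ ‖B‖` as `t → 0⁺` — i.e. `lim_{t↓0} σ₁(θ,t)/t^θ = c_θ‖A_θ‖`, the constant of DATA.md §ET1f-lite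
(rh-dbr TARGET-v9 §M.3 T2).  Nothing here bears on RH. -/
theorem tendsto_opNorm_winOp_div_pow {k : ℕ} (hk : 1 ≤ k) {θ : ℝ} (hθ : θ = (k : ℝ) + 1)
    (A : ∀ t : ℝ, Lp ℝ 2 (volume.restrict (Ioo (-t) t)) →L[ℝ] Lp ℝ 2 (volume.restrict (Ioo (-t) t)))
    (hA : ∀ t φ, (A t φ : ℝ → ℝ) =ᵐ[volume.restrict (Ioo (-t) t)]
      fun x => ∫ y in Ioo (-t) t, limKernel θ (x + y) * φ y)
    {B : Lp ℝ 2 (volume.restrict (Ioo (-1 : ℝ) 1)) →L[ℝ] Lp ℝ 2 (volume.restrict (Ioo (-1 : ℝ) 1))}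
    (hB : ∀ φ, (B φ : ℝ → ℝ) =ᵐ[volume.restrict (Ioo (-1 : ℝ) 1)]
      fun u => ∫ v in Ioo (-1 : ℝ) 1, (max (u + v) 0) ^ k * φ v) :
    Tendsto (fun t : ℝ => ‖A t‖ / t ^ (k + 1)) (𝓝[>] 0)
      (𝓝 ((2 * Real.pi) ^ (k + 1) / (k.factorial : ℝ) * ‖B‖)) := by
  set c : ℝ := (2 * Real.pi) ^ (k + 1) / (k.factorial : ℝ) with hcdef
  set D : ℝ := c * 2 ^ k + 6 * ((k : ℝ) + 1) * (4 * Real.pi * Real.exp 1 / ((k : ℝ) + 1)) ^ (k + 1) with hDdef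
  have key : ∀ᶠ t in 𝓝[>] (0 : ℝ), ‖‖A t‖ / t ^ (k + 1) - c * ‖B‖‖ ≤ 2 * D * t := by
    filter_upwards [Ioo_mem_nhdsGT (show (0 : ℝ) < 1 / 12 by norm_num)] with t ht
    have ht0 : 0 < t := ht.1
    have htk : 0 < t ^ (k + 1) := pow_pos ht0 _
    have h := abs_opNorm_winOp_sub_leading_le hk hθ ht0 ht.2.le (hA t) hB
    rw [Real.norm_eq_abs,
      show ‖A t‖ / t ^ (k + 1) - c * ‖B‖ = (‖A t‖ - c * ‖B‖ * t ^ (k + 1)) / t ^ (k + 1) by field_simp,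
      abs_div, abs_of_pos htk, div_le_iff₀ htk]
    refine h.trans (le_of_eq ?_)
    rw [hDdef, hcdef]
    ring
  have hlim : Tendsto (fun t : ℝ => 2 * D * t) (𝓝[>] 0) (𝓝 0) := by
    have h : Tendsto (fun t : ℝ => 2 * D * t) (𝓝 0) (𝓝 (2 * D * 0)) :=
      (continuous_const.mul continuous_id).tendsto 0
    rw [mul_zero] at h
    exact h.mono_left nhdsWithin_le_nhds
  exact tendsto_sub_nhds_zero_iff.1 (squeeze_zero_norm' key hlim)

end Law

/-! ## §2 Realisation-free two-sided band for `‖𝖪_θ[t]‖` on small windows -/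

section Band

variable {k : ℕ} {θ t : ℝ}
  {A : Lp ℝ 2 (volume.restrict (Ioo (-t) t)) →L[ℝ] Lp ℝ 2 (volume.restrict (Ioo (-t) t))}

/-- RH-FREE · **upper band**: for integer `θ = k+1 ≥ 2`, `0 < t ≤ 1/12` and ANY bounded realisation `A` of `𝖪_θ[t]`,
`‖A‖ ≤ c_θ · 2^θ/√((2θ−1)2θ) · t^θ + 2D_θ t^{θ+1}` (the law + the Hilbert–Schmidt bound for `A_θ`). -/
theorem opNorm_winOp_le_band (hk : 1 ≤ k) (hθ : θ = (k : ℝ) + 1) (ht0 : 0 < t) (ht : t ≤ 1 / 12)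
    (hA : ∀ φ, (A φ : ℝ → ℝ) =ᵐ[volume.restrict (Ioo (-t) t)]
      fun x => ∫ y in Ioo (-t) t, limKernel θ (x + y) * φ y) :
    ‖A‖ ≤ (2 * Real.pi) ^ (k + 1) / (k.factorial : ℝ) *
        Real.sqrt ((2 : ℝ) ^ (2 * k + 2) / ((2 * (k : ℝ) + 1) * (2 * (k : ℝ) + 2))) * t ^ (k + 1) +
      2 * ((2 * Real.pi) ^ (k + 1) / (k.factorial : ℝ) * 2 ^ k +
          6 * ((k : ℝ) + 1) * (4 * Real.pi * Real.exp 1 / ((k : ℝ) + 1)) ^ (k + 1)) * t ^ (k + 2) := by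
  have hb : Continuous fun w : ℝ => (max w 0) ^ k := (continuous_id.max continuous_const).pow k
  obtain ⟨B, hB⟩ := exists_winOp hb 1
  have h := (abs_le.mp (abs_opNorm_winOp_sub_leading_le hk hθ ht0 ht hA hB)).2
  have hBle : ‖B‖ ≤ Real.sqrt ((2 : ℝ) ^ (2 * k + 2) / ((2 * (k : ℝ) + 1) * (2 * (k : ℝ) + 2))) := by
    rw [← Real.sqrt_sq (norm_nonneg B)]
    exact Real.sqrt_le_sqrt (sq_opNorm_onsetOp_le hk hB)
  have hc0 : 0 ≤ (2 * Real.pi) ^ (k + 1) / (k.factorial : ℝ) * t ^ (k + 1) := by positivity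
  have h2 : (2 * Real.pi) ^ (k + 1) / (k.factorial : ℝ) * ‖B‖ * t ^ (k + 1) ≤
      (2 * Real.pi) ^ (k + 1) / (k.factorial : ℝ) *
        Real.sqrt ((2 : ℝ) ^ (2 * k + 2) / ((2 * (k : ℝ) + 1) * (2 * (k : ℝ) + 2))) * t ^ (k + 1) := by
    have := mul_le_mul_of_nonneg_left hBle hc0
    linarith [this]
  linarith

/-- RH-FREE · **lower band** (the first LOWER bound on Suzuki's window norms in the tree): for integer `θ = k+1 ≥ 2`,
`0 < t ≤ 1/12` and ANY bounded realisation `A` of `𝖪_θ[t]`,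
`‖A‖ ≥ c_θ · 2^θ/(θ√(2θ+1)) · t^θ − 2D_θ t^{θ+1}` — so `‖𝖪_θ[t]‖` is EXACTLY of order `t^θ` as `t → 0⁺`. -/
theorem band_le_opNorm_winOp (hk : 1 ≤ k) (hθ : θ = (k : ℝ) + 1) (ht0 : 0 < t) (ht : t ≤ 1 / 12)
    (hA : ∀ φ, (A φ : ℝ → ℝ) =ᵐ[volume.restrict (Ioo (-t) t)]
      fun x => ∫ y in Ioo (-t) t, limKernel θ (x + y) * φ y) :
    (2 * Real.pi) ^ (k + 1) / (k.factorial : ℝ) *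
        Real.sqrt ((2 : ℝ) ^ (2 * k + 2) / (((k : ℝ) + 1) ^ 2 * (2 * (k : ℝ) + 3))) * t ^ (k + 1) -
      2 * ((2 * Real.pi) ^ (k + 1) / (k.factorial : ℝ) * 2 ^ k +
          6 * ((k : ℝ) + 1) * (4 * Real.pi * Real.exp 1 / ((k : ℝ) + 1)) ^ (k + 1)) * t ^ (k + 2) ≤ ‖A‖ := by
  have hb : Continuous fun w : ℝ => (max w 0) ^ k := (continuous_id.max continuous_const).pow k
  obtain ⟨B, hB⟩ := exists_winOp hb 1
  have h := (abs_le.mp (abs_opNorm_winOp_sub_leading_le hk hθ ht0 ht hA hB)).1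
  have hBge : Real.sqrt ((2 : ℝ) ^ (2 * k + 2) / (((k : ℝ) + 1) ^ 2 * (2 * (k : ℝ) + 3))) ≤ ‖B‖ := by
    rw [← Real.sqrt_sq (norm_nonneg B)]
    exact Real.sqrt_le_sqrt (sq_opNorm_onsetOp_ge hk hB)
  have hc0 : 0 ≤ (2 * Real.pi) ^ (k + 1) / (k.factorial : ℝ) * t ^ (k + 1) := by positivity
  have h2 : (2 * Real.pi) ^ (k + 1) / (k.factorial : ℝ) *
        Real.sqrt ((2 : ℝ) ^ (2 * k + 2) / (((k : ℝ) + 1) ^ 2 * (2 * (k : ℝ) + 3))) * t ^ (k + 1) ≤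
      (2 * Real.pi) ^ (k + 1) / (k.factorial : ℝ) * ‖B‖ * t ^ (k + 1) := by
    have := mul_le_mul_of_nonneg_left hBge hc0
    linarith [this]
  linarith

end Band

end Summit.RiemannHypothesis.RiemannHypothesis.Theorems.SuzukiWindowsDoorSmallWindowLaw

end
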